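import Summits.AtomisticToContinuum.HydrodynamicLimit.Theorems.JParityClosureParityBandClosureInverseCollisionInvariance
import HarnessLib

/-!
# Kinetic slaving (stub S3c `stub_kineticSlavingOfTools` of the line `preshock-kinetic-slaving`,
# crux `JParityClosure.EvenStressEnskog`, stmt-AtomisticToContinuum-13079) — first mile 2:
# the Metropolis fold (measure-level parity split and H-theorem for a reweighted collision measure)

The deterministic identity at the heart of the kinetic core (audit h2/h4, plan `I₄` step (iv)): let `κ` be a
measure on a "collision space" `Q` carrying a measurable involution `J` (the inverse collision
`(n, v, w) ↦ (−n, v′, w′)`) and a measurable `J`-ODD function `F` (the surprisal jump).  The crux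
`OddContactSymmetry` asserts, in the limit, that the METROPOLIS-reweighted measure
`ν = min(1, e^{−F}) · κ` integrates every bounded `J`-odd mark to zero, i.e. `ν` is `J`-invariant.  Under that
single hypothesis we prove, with no absolute continuity and no density for `κ`:

* `measurePreserving_cosh_of_metropolis_invariant`: the COSH-reweighted measure `(1 + e^{−F}) · κ` (the route's
  rev-1 weight) is `J`-invariant too (`(1 + e^{−F}) = min(1,e^{−F}) · (1 + e^{|F|})` with a `J`-even second
  factor, `min_one_exp_neg_mul_one_add_exp_abs`);
* `lintegral_exp_neg_le_of_metropolis_invariant`: `∫ e^{−F} dκ ≤ 2 κ(Q)` — the anti-dissipative tail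
  `{F < 0}` of `κ` is the `J`-image of `e^{−F} κ|_{F > 0}`, so the cosh weight is automatically integrable
  (`integrable_one_add_exp_neg_of_metropolis_invariant`);
* `integral_mul_one_add_exp_neg_eq_zero_of_metropolis_invariant`: every bounded measurable `J`-odd `Δ` has
  `∫ Δ (1 + e^{−F}) dκ = 0` (the ODD FLUX vanishes), hence the measure-level PARITY SPLIT
  `∫ Δ dκ = ½ ∫ Δ (1 − e^{−F}) dκ` (`integral_eq_half_integral_mul_one_sub_exp_neg`);
* `ae_eq_zero_of_metropolis_invariant_of_integral_le` (the H-THEOREM of the fold): if moreover `F` is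
  `κ`-integrable and BALANCED, `∫ F dκ ≤ 0` (free collisional balance), then `F = 0` `κ`-a.e. — twisted balance
  `h h_* = h′ h′_*` on the support of the collision measure — because `F (1 − e^{−F}) ≥ 0` pointwise;
* `hardSphere_ae_eq_zero_of_metropolis_invariant` (registered sub-goal): the same on the hard-sphere collision
  space `(V3 × V3) × S²` with the inverse collision `J(p, ω) = (collide ω p, −ω)`.

This is the finite-measure (possibly singular) form of the proved `ParitySplit` identities for kernels with
densities (`paritySplit_proof`), which is what random Young-measure limits of empirical collision measures need.
Relation to the landed measure-level chain of crux `ParityBandClosure` (stmt-17608, namespace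
`ParityBandClosureDetailedBalance`): `stub_detailedBalanceOfSymmetricRecord` (p138663) proves the EQUALITY case
`∫ F dκ = 0 ⇒ F = 0` a.e. by the `max(1, e^{F})` inversion; NEW here are the cosh transfer, the free tail bound,
the parity split for arbitrary bounded odd marks `Δ`, and the H-INEQUALITY `0 ≤ ∫ F dκ`
(`integral_nonneg_of_metropolis_invariant`: entropy production has a sign under Metropolis invariance alone), from
which the `≤ 0` balance case follows.  The scalar facts `min_one_exp_neg_pos` and the measurability /
involutivity of the inverse collision are REUSED from that chain (`measurable_inverseCollision`,
`inverseCollision_inverseCollision`).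

References: C. Cercignani, R. Illner, M. Pulvirenti, *The Mathematical Theory of Dilute Gases* (1994), §3.2
(Boltzmann inequality; the only ingredient is the measure-preserving involution); W. K. Hastings, Biometrika 57
(1970) 97–109 and P. H. Peskun, Biometrika 60 (1973) 607–612 (the acceptance class `a(F) = e^{−F} a(−F)`,
Metropolis `min(1, e^{−F})` and Barker/cosh-type members).
-/

noncomputable section

open MeasureTheory Set Filter Topology Function
open scoped ENNReal

namespace Summit.AtomisticToContinuum.HydrodynamicLimit.Theorems.EvenStressEnskog

open Summit.AtomisticToContinuum.HydrodynamicLimit.Theorems.ParityBandClosureDetailedBalance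
  (min_one_exp_neg_pos measurable_inverseCollision inverseCollision_inverseCollision)

variable {Q : Type*} [MeasurableSpace Q]

/-! ## Pointwise algebra of the weights -/

/-- The Metropolis weight times the `J`-even factor `1 + e^{|x|}` is the cosh weight:
`min(1, e^{−x}) (1 + e^{|x|}) = 1 + e^{−x}`. [folklore] -/
theorem min_one_exp_neg_mul_one_add_exp_abs (x : ℝ) :
    min 1 (Real.exp (-x)) * (1 + Real.exp |x|) = 1 + Real.exp (-x) := by
  rcases le_or_gt 0 x with hx | hx
  · have h1 : Real.exp (-x) ≤ 1 := Real.exp_le_one_iff.2 (by linarith)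
    rw [min_eq_right h1, abs_of_nonneg hx, mul_add, mul_one, ← Real.exp_add, neg_add_cancel,
      Real.exp_zero, add_comm]
  · have h1 : 1 ≤ Real.exp (-x) := Real.one_le_exp (by linarith)
    rw [min_eq_left h1, abs_of_neg hx, one_mul]

/-- `x (1 − e^{−x}) ≥ 0` for every real `x` (both factors have the sign of `x`). [folklore] -/
theorem mul_one_sub_exp_neg_nonneg (x : ℝ) : 0 ≤ x * (1 - Real.exp (-x)) := by
  rcases le_or_gt 0 x with hx | hx
  · exact mul_nonneg hx (sub_nonneg.2 (Real.exp_le_one_iff.2 (by linarith)))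
  · have h1 : 1 < Real.exp (-x) := Real.one_lt_exp_iff.2 (by linarith)
    nlinarith

/-- `x (1 − e^{−x}) = 0` only at `x = 0`. [folklore] -/
theorem eq_zero_of_mul_one_sub_exp_neg_eq_zero {x : ℝ} (h : x * (1 - Real.exp (-x)) = 0) : x = 0 := by
  rcases mul_eq_zero.1 h with h0 | h0
  · exact h0
  · have h1 : Real.exp (-x) = 1 := by linarith
    have h2 : -x = 0 := by simpa using congrArg Real.log h1
    linarith

/-! ## The fold -/

section Fold

variable (J : Q → Q) (hJ : Measurable J) (hJJ : Involutive J) (κ : Measure Q) (F : Q → ℝ)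
  (hF : Measurable F)
  (hinv : (κ.withDensity fun q => ENNReal.ofReal (min 1 (Real.exp (-F q)))).map J =
    κ.withDensity fun q => ENNReal.ofReal (min 1 (Real.exp (-F q))))

include hF in
/-- Measurability of the Metropolis weight. [folklore] -/
theorem measurable_metropolisWeight : Measurable fun q => ENNReal.ofReal (min 1 (Real.exp (-F q))) :=
  (measurable_const.min hF.neg.exp).ennreal_ofReal

include hJ hJJ hF hinv in
/-- **`J`-invariance transfers from the Metropolis weight to the cosh weight**: if `min(1,e^{−F}) κ` is
`J`-invariant then so is `(1 + e^{−F}) κ` (multiply by the `J`-even factor `1 + e^{|F|}`). [folklore] -/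
theorem measurePreserving_cosh_of_metropolis_invariant (hFodd : ∀ q, F (J q) = -F q) :
    MeasurePreserving J (κ.withDensity fun q => ENNReal.ofReal (1 + Real.exp (-F q)))
      (κ.withDensity fun q => ENNReal.ofReal (1 + Real.exp (-F q))) := by
  set w : Q → ℝ≥0∞ := fun q => ENNReal.ofReal (min 1 (Real.exp (-F q))) with hw
  set g : Q → ℝ≥0∞ := fun q => ENNReal.ofReal (1 + Real.exp |F q|) with hg
  have hwm : Measurable w := measurable_metropolisWeight F hF
  have hgm : Measurable g := (measurable_const.add (continuous_abs.measurable.comp hF).exp).ennreal_ofReal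
  have hgJ : ∀ q, g (J q) = g q := fun q => by simp only [hg, hFodd, abs_neg]
  -- `(1 + e^{-F}) κ = g · (w κ)`
  have hρ : (κ.withDensity fun q => ENNReal.ofReal (1 + Real.exp (-F q))) =
      (κ.withDensity w).withDensity g := by
    rw [← withDensity_mul _ hwm hgm]
    congr 1
    funext q
    simp only [Pi.mul_apply, hw, hg]
    rw [← ENNReal.ofReal_mul (min_one_exp_neg_pos _).le, min_one_exp_neg_mul_one_add_exp_abs]
  set e : Q ≃ᵐ Q := MeasurableEquiv.ofInvolutive J hJJ hJ with he
  have hecoe : (e : Q → Q) = J := rfl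
  refine ⟨hJ, ?_⟩
  rw [hρ]
  ext s hs
  rw [Measure.map_apply hJ hs, withDensity_apply _ hs, withDensity_apply _ (hJ hs)]
  -- `∫⁻_{J⁻¹ s} g d(wκ) = ∫⁻ (s.indicator g) ∘ J d(wκ) = ∫⁻ s.indicator g d((wκ).map J)`
  have h1 : ∫⁻ q in J ⁻¹' s, g q ∂κ.withDensity w = ∫⁻ q, s.indicator g (J q) ∂κ.withDensity w := by
    rw [← lintegral_indicator (hJ hs)]
    congr 1
    funext q
    by_cases hq : J q ∈ s
    · rw [Set.indicator_of_mem (show q ∈ J ⁻¹' s from hq), Set.indicator_of_mem hq, hgJ]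
    · rw [Set.indicator_of_notMem (show q ∉ J ⁻¹' s from hq), Set.indicator_of_notMem hq]
  rw [h1, ← hecoe, ← lintegral_map_equiv (s.indicator g) e, hecoe, hinv, lintegral_indicator hs]

include hJ hJJ hF hinv in
/-- **The anti-dissipative tail is controlled for free**: `∫ e^{−F} dκ ≤ 2 κ(Q)` — on `{F ≥ 0}` the
integrand is `≤ 1`, and by invariance of `w κ` (`w = min(1,e^{−F})`, `= 1` on `{F < 0}`),
`∫_{F<0} e^{−F} dκ = ∫ 1_{F<0} e^{−F} d(wκ) = ∫ (1_{F<0} e^{−F}) ∘ J · w dκ = ∫_{F>0} e^{F} e^{−F} dκ = κ{F > 0}`.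
[folklore] -/
theorem lintegral_exp_neg_le_of_metropolis_invariant (hFodd : ∀ q, F (J q) = -F q) :
    ∫⁻ q, ENNReal.ofReal (Real.exp (-F q)) ∂κ ≤ 2 * κ Set.univ := by
  set w : Q → ℝ≥0∞ := fun q => ENNReal.ofReal (min 1 (Real.exp (-F q))) with hw
  have hwm : Measurable w := measurable_metropolisWeight F hF
  set e : Q ≃ᵐ Q := MeasurableEquiv.ofInvolutive J hJJ hJ with he
  have hecoe : (e : Q → Q) = J := rfl
  have hneg : MeasurableSet {q | F q < 0} := measurableSet_lt hF measurable_const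
  have hposm : Measurable fun q => ENNReal.ofReal (Real.exp (-F q)) := hF.neg.exp.ennreal_ofReal
  -- split `univ = {F < 0} ∪ {0 ≤ F}`
  have hsplit : ∫⁻ q, ENNReal.ofReal (Real.exp (-F q)) ∂κ =
      ∫⁻ q in {q | F q < 0}, ENNReal.ofReal (Real.exp (-F q)) ∂κ +
        ∫⁻ q in {q | F q < 0}ᶜ, ENNReal.ofReal (Real.exp (-F q)) ∂κ :=
    (lintegral_add_compl _ hneg).symm
  -- the tail piece: rewrite against `w κ` (where `w = 1`) and transport by `J`
  have htail : ∫⁻ q in {q | F q < 0}, ENNReal.ofReal (Real.exp (-F q)) ∂κ ≤ κ Set.univ := by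
    -- `1_{F<0} e^{-F} = 1_{F<0} e^{-F} · w` pointwise
    have hpt : ∀ q, ({q | F q < 0} : Set Q).indicator (fun q => ENNReal.ofReal (Real.exp (-F q))) q =
        w q * ({q | F q < 0} : Set Q).indicator (fun q => ENNReal.ofReal (Real.exp (-F q))) q := by
      intro q
      by_cases hq : q ∈ {q | F q < 0}
      · have hq' : F q < 0 := hq
        have h1 : min 1 (Real.exp (-F q)) = 1 := min_eq_left (Real.one_le_exp (by linarith))
        simp only [Set.indicator_of_mem hq, hw, h1, ENNReal.ofReal_one, one_mul]
      · simp only [Set.indicator_of_notMem hq, mul_zero]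
    have hind : Measurable (({q | F q < 0} : Set Q).indicator fun q => ENNReal.ofReal (Real.exp (-F q))) :=
      hposm.indicator hneg
    calc ∫⁻ q in {q | F q < 0}, ENNReal.ofReal (Real.exp (-F q)) ∂κ
        = ∫⁻ q, ({q | F q < 0} : Set Q).indicator (fun q => ENNReal.ofReal (Real.exp (-F q))) q ∂κ :=
          (lintegral_indicator hneg _).symm
      _ = ∫⁻ q, (w * ({q | F q < 0} : Set Q).indicator (fun q => ENNReal.ofReal (Real.exp (-F q)))) q ∂κ := by
          congr 1; funext q; exact hpt q
      _ = ∫⁻ q, ({q | F q < 0} : Set Q).indicator (fun q => ENNReal.ofReal (Real.exp (-F q))) q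
            ∂κ.withDensity w := (lintegral_withDensity_eq_lintegral_mul _ hwm hind).symm
      _ = ∫⁻ q, ({q | F q < 0} : Set Q).indicator (fun q => ENNReal.ofReal (Real.exp (-F q))) q
            ∂(κ.withDensity w).map J := by rw [hinv]
      _ = ∫⁻ q, ({q | F q < 0} : Set Q).indicator (fun q => ENNReal.ofReal (Real.exp (-F q))) (J q)
            ∂κ.withDensity w := by rw [← hecoe, lintegral_map_equiv _ e]
      _ = ∫⁻ q, (w * fun q => ({q | F q < 0} : Set Q).indicator
            (fun q => ENNReal.ofReal (Real.exp (-F q))) (J q)) q ∂κ :=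
          lintegral_withDensity_eq_lintegral_mul _ hwm (hind.comp hJ)
      _ ≤ ∫⁻ _q, 1 ∂κ := by
          refine lintegral_mono fun q => ?_
          simp only [Pi.mul_apply]
          by_cases hq : J q ∈ {q | F q < 0}
          · have hq' : F (J q) < 0 := hq
            rw [hFodd] at hq'
            have hFq : 0 < F q := by linarith
            have h1 : min 1 (Real.exp (-F q)) = Real.exp (-F q) :=
              min_eq_right (Real.exp_le_one_iff.2 (by linarith))
            rw [Set.indicator_of_mem hq, hFodd, neg_neg, hw]
            dsimp only
            rw [h1, ← ENNReal.ofReal_mul (Real.exp_pos _).le, ← Real.exp_add, neg_add_cancel,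
              Real.exp_zero, ENNReal.ofReal_one]
          · rw [Set.indicator_of_notMem hq, mul_zero]; exact zero_le_one
      _ = κ Set.univ := by rw [lintegral_const, one_mul]
  -- the bulk piece: integrand `≤ 1`
  have hbulk : ∫⁻ q in {q | F q < 0}ᶜ, ENNReal.ofReal (Real.exp (-F q)) ∂κ ≤ κ Set.univ := by
    calc ∫⁻ q in {q | F q < 0}ᶜ, ENNReal.ofReal (Real.exp (-F q)) ∂κ
        ≤ ∫⁻ _q in {q | F q < 0}ᶜ, 1 ∂κ := by
          refine setLIntegral_mono measurable_const fun q hq => ?_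
          have hq' : ¬ F q < 0 := hq
          rw [← ENNReal.ofReal_one]
          exact ENNReal.ofReal_le_ofReal (Real.exp_le_one_iff.2 (by linarith [not_lt.1 hq']))
      _ ≤ κ Set.univ := by
          rw [lintegral_const, one_mul, Measure.restrict_apply_univ]; exact measure_mono (subset_univ _)
  calc ∫⁻ q, ENNReal.ofReal (Real.exp (-F q)) ∂κ
      = _ := hsplit
    _ ≤ κ Set.univ + κ Set.univ := add_le_add htail hbulk
    _ = 2 * κ Set.univ := by rw [two_mul]

include hJ hJJ hF hinv in
/-- Under a finite `κ`, the cosh weight `1 + e^{−F}` is `κ`-integrable. [folklore] -/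
theorem integrable_one_add_exp_neg_of_metropolis_invariant [IsFiniteMeasure κ]
    (hFodd : ∀ q, F (J q) = -F q) : Integrable (fun q => 1 + Real.exp (-F q)) κ := by
  refine (integrable_const (1 : ℝ)).add ?_
  refine ⟨hF.neg.exp.aestronglyMeasurable, ?_⟩
  have h := lintegral_exp_neg_le_of_metropolis_invariant J hJ hJJ κ F hF hinv hFodd
  have hfin : 2 * κ Set.univ < ∞ := ENNReal.mul_lt_top (by simp) (measure_lt_top _ _)
  refine lt_of_le_of_lt ?_ (h.trans_lt hfin)
  refine lintegral_mono fun q => ?_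
  dsimp only
  rw [Real.enorm_eq_ofReal (Real.exp_pos _).le]

include hJ hJJ hF hinv in
/-- **The odd flux vanishes**: for every bounded measurable `J`-odd `Δ`, `∫ Δ (1 + e^{−F}) dκ = 0`
(`κ` finite; the cosh-reweighted measure is `J`-invariant and `Δ ∘ J = −Δ`). [folklore] -/
theorem integral_mul_one_add_exp_neg_eq_zero_of_metropolis_invariant [IsFiniteMeasure κ]
    (hFodd : ∀ q, F (J q) = -F q) (Δ : Q → ℝ) (hΔodd : ∀ q, Δ (J q) = -Δ q) :
    ∫ q, Δ q * (1 + Real.exp (-F q)) ∂κ = 0 := by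
  set ρ : Measure Q := κ.withDensity fun q => ENNReal.ofReal (1 + Real.exp (-F q)) with hρ
  have hmp := measurePreserving_cosh_of_metropolis_invariant J hJ hJJ κ F hF hinv hFodd
  set e : Q ≃ᵐ Q := MeasurableEquiv.ofInvolutive J hJJ hJ with he
  have hecoe : (e : Q → Q) = J := rfl
  have hmp' : MeasurePreserving e ρ ρ := by rw [show (e : Q → Q) = J from hecoe]; exact hmp
  -- `∫ Δ dρ = ∫ Δ ∘ J dρ = -∫ Δ dρ`
  have h1 : ∫ q, Δ q ∂ρ = 0 := by
    have h := hmp'.integral_comp' Δ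
    simp only [hecoe, hΔodd, integral_neg] at h
    linarith
  -- `∫ Δ dρ = ∫ (1 + e^{-F}) Δ dκ`
  have hm : Measurable fun q => ENNReal.ofReal (1 + Real.exp (-F q)) :=
    (measurable_const.add hF.neg.exp).ennreal_ofReal
  have h2 : ∫ q, Δ q ∂ρ = ∫ q, (1 + Real.exp (-F q)) * Δ q ∂κ := by
    rw [hρ, integral_withDensity_eq_integral_toReal_smul₀ hm.aemeasurable
      (Eventually.of_forall fun _ => ENNReal.ofReal_lt_top)]
    refine integral_congr_ae (Eventually.of_forall fun q => ?_)
    dsimp only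
    rw [ENNReal.toReal_ofReal (by positivity), smul_eq_mul]
  rw [h2] at h1
  simpa only [mul_comm] using h1

include hJ hJJ hF hinv in
/-- **Measure-level parity split**: for every bounded measurable `J`-odd `Δ`,
`∫ Δ dκ = ½ ∫ Δ (1 − e^{−F}) dκ` (`κ` finite). [folklore] -/
theorem integral_eq_half_integral_mul_one_sub_exp_neg [IsFiniteMeasure κ]
    (hFodd : ∀ q, F (J q) = -F q) (Δ : Q → ℝ) (hΔm : Measurable Δ) (hΔbdd : ∃ C : ℝ, ∀ q, |Δ q| ≤ C)
    (hΔodd : ∀ q, Δ (J q) = -Δ q) :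
    ∫ q, Δ q ∂κ = (1 / 2) * ∫ q, Δ q * (1 - Real.exp (-F q)) ∂κ := by
  obtain ⟨C, hC⟩ := hΔbdd
  have h0 := integral_mul_one_add_exp_neg_eq_zero_of_metropolis_invariant J hJ hJJ κ F hF hinv hFodd Δ hΔodd
  have hΔi : Integrable Δ κ :=
    ⟨hΔm.aestronglyMeasurable, HasFiniteIntegral.of_bounded (C := C)
      (Eventually.of_forall fun q => by rw [Real.norm_eq_abs]; exact hC q)⟩
  have hcosh := integrable_one_add_exp_neg_of_metropolis_invariant J hJ hJJ κ F hF hinv hFodd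
  have hΔw : Integrable (fun q => Δ q * (1 + Real.exp (-F q))) κ := by
    refine (hcosh.const_mul C).mono' (hΔm.mul (measurable_const.add hF.neg.exp)).aestronglyMeasurable
      (Eventually.of_forall fun q => ?_)
    rw [Real.norm_eq_abs, abs_mul, abs_of_pos (by positivity : 0 < 1 + Real.exp (-F q))]
    exact mul_le_mul_of_nonneg_right (hC q) (by positivity)
  have hΔe : Integrable (fun q => Δ q * Real.exp (-F q)) κ := by
    have : (fun q => Δ q * Real.exp (-F q)) = fun q => Δ q * (1 + Real.exp (-F q)) - Δ q := by
      funext q; ring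
    rw [this]; exact hΔw.sub hΔi
  have hsplit1 : ∫ q, Δ q * (1 + Real.exp (-F q)) ∂κ = ∫ q, Δ q ∂κ + ∫ q, Δ q * Real.exp (-F q) ∂κ := by
    rw [← integral_add hΔi hΔe]; congr 1; funext q; ring
  have hsplit2 : ∫ q, Δ q * (1 - Real.exp (-F q)) ∂κ = ∫ q, Δ q ∂κ - ∫ q, Δ q * Real.exp (-F q) ∂κ := by
    rw [← integral_sub hΔi hΔe]; congr 1; funext q; ring
  rw [hsplit2]
  linarith [hsplit1, h0]

include hJ hJJ hF hinv in
/-- **The H-inequality of the fold**: under Metropolis `J`-invariance alone (`κ` finite, `F` and `F e^{−F}`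
`κ`-integrable), `0 ≤ ∫ F dκ` — indeed `2 ∫ F dκ = ∫ F (1 − e^{−F}) dκ` with a pointwise nonnegative integrand
(the sign of Boltzmann's entropy production, with no density and no chaos assumption). [folklore] -/
theorem integral_nonneg_of_metropolis_invariant [IsFiniteMeasure κ]
    (hFodd : ∀ q, F (J q) = -F q) (hFi : Integrable F κ)
    (hFe : Integrable (fun q => F q * Real.exp (-F q)) κ) :
    0 ≤ ∫ q, F q ∂κ := by
  have h0 := integral_mul_one_add_exp_neg_eq_zero_of_metropolis_invariant J hJ hJJ κ F hF hinv hFodd F hFodd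
  have hsplit1 : ∫ q, F q * (1 + Real.exp (-F q)) ∂κ = ∫ q, F q ∂κ + ∫ q, F q * Real.exp (-F q) ∂κ := by
    rw [← integral_add hFi hFe]; congr 1; funext q; ring
  have hsplit2 : ∫ q, F q * (1 - Real.exp (-F q)) ∂κ = ∫ q, F q ∂κ - ∫ q, F q * Real.exp (-F q) ∂κ := by
    rw [← integral_sub hFi hFe]; congr 1; funext q; ring
  have hge : 0 ≤ ∫ q, F q * (1 - Real.exp (-F q)) ∂κ :=
    integral_nonneg fun q => mul_one_sub_exp_neg_nonneg (F q)
  linarith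

include hJ hJJ hF hinv in
/-- **The H-theorem of the fold**: if `min(1,e^{−F}) κ` is `J`-invariant (`κ` finite), `F` is `κ`-integrable and
BALANCED in the weak sense `∫ F dκ ≤ 0`, then `F = 0` `κ`-a.e. (twisted balance on the support of the collision
measure).  Indeed `∫ F (1 + e^{−F}) dκ = 0` by oddness, so `∫ F (1 − e^{−F}) dκ = 2 ∫ F dκ ≤ 0` with a pointwise
nonnegative integrand vanishing only at `F = 0`. [folklore] -/
theorem ae_eq_zero_of_metropolis_invariant_of_integral_le [IsFiniteMeasure κ]
    (hFodd : ∀ q, F (J q) = -F q) (hFi : Integrable F κ)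
    (hFe : Integrable (fun q => F q * Real.exp (-F q)) κ) (hbal : ∫ q, F q ∂κ ≤ 0) :
    ∀ᵐ q ∂κ, F q = 0 := by
  have h0 := integral_mul_one_add_exp_neg_eq_zero_of_metropolis_invariant J hJ hJJ κ F hF hinv hFodd F hFodd
  have hsplit1 : ∫ q, F q * (1 + Real.exp (-F q)) ∂κ = ∫ q, F q ∂κ + ∫ q, F q * Real.exp (-F q) ∂κ := by
    rw [← integral_add hFi hFe]; congr 1; funext q; ring
  have hPi : Integrable (fun q => F q * (1 - Real.exp (-F q))) κ := by
    have : (fun q => F q * (1 - Real.exp (-F q))) = fun q => F q - F q * Real.exp (-F q) := by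
      funext q; ring
    rw [this]; exact hFi.sub hFe
  have hsplit2 : ∫ q, F q * (1 - Real.exp (-F q)) ∂κ = ∫ q, F q ∂κ - ∫ q, F q * Real.exp (-F q) ∂κ := by
    rw [← integral_sub hFi hFe]; congr 1; funext q; ring
  have hP0 : ∫ q, F q * (1 - Real.exp (-F q)) ∂κ = 0 := by
    have hle : ∫ q, F q * (1 - Real.exp (-F q)) ∂κ ≤ 0 := by linarith [hsplit1, hsplit2, h0, hbal]
    have hge : 0 ≤ ∫ q, F q * (1 - Real.exp (-F q)) ∂κ :=
      integral_nonneg fun q => mul_one_sub_exp_neg_nonneg (F q)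
    linarith
  have hae := (integral_eq_zero_iff_of_nonneg (fun q => mul_one_sub_exp_neg_nonneg (F q)) hPi).1 hP0
  filter_upwards [hae] with q hq
  exact eq_zero_of_mul_one_sub_exp_neg_eq_zero hq

end Fold

/-! ## The hard-sphere collision space -/

section HardSphere

open Literature.MathematicalPhysics.KineticTheory Literature.Analysis.FluidPDE

/-- The inverse collision `J(p, ω) = (collide ω p, −ω)` of the hard-sphere collision space is an involution
(landed `inverseCollision_inverseCollision`, restated as `Function.Involutive`). [folklore] -/
theorem involutive_inverseCollision :
    Involutive (fun q : (V3 × V3) × Metric.sphere (0 : V3) 1 => (collide q.2 q.1, -q.2)) :=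
  fun q => inverseCollision_inverseCollision q

/-- **H-theorem of the Metropolis fold on the hard-sphere collision space** (registered sub-goal of S3c): for a
finite measure `κ` on `(V3 × V3) × S²` (a limit empirical collision measure at one space-time point) and a
measurable surprisal jump `F`, odd under the inverse collision `J(p,ω) = (collide ω p, −ω)`: if the
Metropolis-reweighted measure `min(1,e^{−F}) κ` is `J`-invariant (limit content of `OddContactSymmetry`), `F` and
`F e^{−F}` are `κ`-integrable (admissibility) and `∫ F dκ ≤ 0` (free collisional balance), then `F = 0` `κ`-a.e.
(twisted balance on the support of the collision measure — the input of `RateFloor` + `ParityRigidity`). [folklore] -/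
theorem hardSphere_ae_eq_zero_of_metropolis_invariant :
    ∀ (κ : Measure ((V3 × V3) × Metric.sphere (0 : V3) 1)) [IsFiniteMeasure κ]
    (F : (V3 × V3) × Metric.sphere (0 : V3) 1 → ℝ), Measurable F →
    (∀ q, F (collide q.2 q.1, -q.2) = -F q) →
    (κ.withDensity fun q => ENNReal.ofReal (min 1 (Real.exp (-F q)))).map
        (fun q => (collide q.2 q.1, -q.2)) =
      κ.withDensity (fun q => ENNReal.ofReal (min 1 (Real.exp (-F q)))) →
    Integrable F κ → Integrable (fun q => F q * Real.exp (-F q)) κ → ∫ q, F q ∂κ ≤ 0 →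
    ∀ᵐ q ∂κ, F q = 0 :=
  fun κ _ F hF hFodd hinv hFi hFe hbal =>
    ae_eq_zero_of_metropolis_invariant_of_integral_le _ measurable_inverseCollision
      involutive_inverseCollision κ F hF hinv hFodd hFi hFe hbal

end HardSphere

end Summit.AtomisticToContinuum.HydrodynamicLimit.Theorems.EvenStressEnskog

end
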